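import Summits.Ventures.PercRepro.Night2GoodTwoD2Targets

/-!
# night-2: the shape of a distance-2 target

For a lossy big pair `(B, z)` (set `Q = insert z B`) without good point, the three thin faces are `Q.erase wₐ`,
`Q.erase w_b`, `Q.erase w_c` for the three coloops of `Q ∖ K`; a point of `G ∖ Q` off one thin hyperplane lies on the
other two (covering); and a distance-2 target `T = insert p₁ (insert p₂ Q)` with `p₁ ∉ clF (Q.erase wₐ)`,
`p₂ ∉ clF (Q.erase w_b)` is `R ∪ {wₐ, p₁} ∪ {w_b, p₂} ∪ {w_c}` with `R = Q ∖ K ∖ {wₐ, w_b, w_c}` of rank `2` and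
at least three points.  This module extracts that shape (`d2Target_shape`), in the vocabulary of the closures
`clF (R ∪ {·, ·})` off `K`.
-/

namespace PercRepro.Shadow

open PercRepro.ThmH PercRepro.PerFlat

variable {α : Type*} [DecidableEq α] {M : Matroid α} [M.Finite] {G : Finset α}

/-- A lossy big set has exactly three thin faces. -/
theorem card_thinFacesOf_eq_three (hG : G ∈ flatsQ M (5 + 1)) (hd : (gr M \ G).card = 2)
    (hk : kColoops M G = 1) (hs : ∀ e ∈ gr M, ∀ f ∈ gr M, e ≠ f → rkN M {e, f} = 2)
    (hl : ∀ e ∈ gr M, M.Indep {e}) {B : Finset α} (hB : B ∈ thinMembers M 5 G)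
    (hbig : 5 ≤ (B \ coloops M G).card) {z : α} (hz : z ∈ G \ clF M B) (h : loss M 5 G B z ≠ 0) :
    (thinFacesOf M 5 G (insert z B)).card = 3 := by
  rw [thinFacesOf_eq_image_erase hG hd hk hs hl hB hbig hz h, Finset.card_image_of_injOn,
    card_coloops_eq_three_of_loss_ne_zero hG hd hk hs hl hB hbig hz h]
  intro w hw w' hw' heq
  simp only [Finset.mem_coe] at hw hw'
  have hw'Q : w' ∈ insert z B := (Finset.mem_sdiff.1 (mem_coloops.1 hw').1).1
  by_contra hne
  have hmem : w' ∈ (insert z B).erase w := Finset.mem_erase.2 ⟨Ne.symm hne, hw'Q⟩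
  simp only at heq
  rw [heq] at hmem
  exact (Finset.mem_erase.1 hmem).1 rfl

/-- **Covering**: without good point, a point of `G ∖ Q` off one thin hyperplane lies on every other one. -/
theorem mem_clF_of_not_gtPts (hG : G ∈ flatsQ M (5 + 1)) (hd : (gr M \ G).card = 2)
    (hk : kColoops M G = 1) (hs : ∀ e ∈ gr M, ∀ f ∈ gr M, e ≠ f → rkN M {e, f} = 2)
    (hl : ∀ e ∈ gr M, M.Indep {e}) {B : Finset α} (hB : B ∈ thinMembers M 5 G)
    (hbig : 5 ≤ (B \ coloops M G).card) {z : α} (hz : z ∈ G \ clF M B) (h : loss M 5 G B z ≠ 0)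
    (hno : ¬ (gtPts M 5 G (insert z B)).Nonempty) {x : α} (hx : x ∈ G \ insert z B) {F : Finset α}
    (hF : F ∈ thinFacesOf M 5 G (insert z B)) (hxF : x ∉ clF M F) {F' : Finset α}
    (hF' : F' ∈ thinFacesOf M 5 G (insert z B)) (hFF' : F' ≠ F) : x ∈ clF M F' := by
  by_contra hxF'
  apply hno
  refine ⟨x, ?_⟩
  simp only [gtPts, Finset.mem_filter]
  refine ⟨hx, ?_⟩
  have hcard := card_thinFacesOf_eq_three hG hd hk hs hl hB hbig hz h
  have hsub : (thinFacesOf M 5 G (insert z B)).filter (fun F'' => x ∈ clF M F'') ⊆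
      ((thinFacesOf M 5 G (insert z B)).erase F).erase F' := by
    intro F'' hF''
    rw [Finset.mem_filter] at hF''
    refine Finset.mem_erase.2 ⟨?_, Finset.mem_erase.2 ⟨?_, hF''.1⟩⟩
    · rintro rfl
      exact hxF' hF''.2
    · rintro rfl
      exact hxF hF''.2
  calc ((thinFacesOf M 5 G (insert z B)).filter (fun F'' => x ∈ clF M F'')).card
      ≤ (((thinFacesOf M 5 G (insert z B)).erase F).erase F').card := Finset.card_le_card hsub
    _ = 1 := by
        rw [Finset.card_erase_of_mem (Finset.mem_erase.2 ⟨hFF', hF'⟩), Finset.card_erase_of_mem hF, hcard]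

/-- The points of `Q' = R ∪ {w, w', w''}` off `w` lie in `R ∪ {w', w''}`. -/
theorem erase_coloop_subset_aux {Q' R : Finset α} {w w' w'' : α}
    (hQ' : Q' = R ∪ {w, w', w''}) (a : α) (ha : a ∈ Q'.erase w) : a ∈ R ∪ {w', w''} := by
  rw [Finset.mem_erase, hQ', Finset.mem_union, Finset.mem_insert, Finset.mem_insert,
    Finset.mem_singleton] at ha
  rw [Finset.mem_union, Finset.mem_insert, Finset.mem_singleton]
  rcases ha.2 with h | h | h | h
  · exact Or.inl h
  · exact absurd h ha.1
  · exact Or.inr (Or.inl h)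
  · exact Or.inr (Or.inr h)

/-- `R ∪ {w', w''} ⊆ Q'.erase w` when `w ∉ R`, `w ≠ w'`, `w ≠ w''`. -/
theorem subset_erase_coloop_aux {Q' R : Finset α} {w w' w'' : α}
    (hQ' : Q' = R ∪ {w, w', w''}) (hwR : w ∉ R) (hww' : w ≠ w') (hww'' : w ≠ w'') :
    R ∪ {w', w''} ⊆ Q'.erase w := by
  intro a ha
  rw [Finset.mem_union, Finset.mem_insert, Finset.mem_singleton] at ha
  rw [Finset.mem_erase, hQ', Finset.mem_union, Finset.mem_insert, Finset.mem_insert, Finset.mem_singleton]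
  rcases ha with h | rfl | rfl
  · exact ⟨fun hw => hwR (hw ▸ h), Or.inl h⟩
  · exact ⟨hww'.symm, Or.inr (Or.inr (Or.inl rfl))⟩
  · exact ⟨hww''.symm, Or.inr (Or.inr (Or.inr rfl))⟩

/-- Permuting the three named points. -/
theorem triple_perm_aux {R : Finset α} {w w' w'' : α} : R ∪ {w, w', w''} = R ∪ {w', w, w''} := by
  ext a
  simp only [Finset.mem_union, Finset.mem_insert, Finset.mem_singleton]
  tauto

/-- Permuting the three named points. -/
theorem triple_perm_aux' {R : Finset α} {w w' w'' : α} : R ∪ {w, w', w''} = R ∪ {w'', w, w'} := by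
  ext a
  simp only [Finset.mem_union, Finset.mem_insert, Finset.mem_singleton]
  tauto

/-- **The shape of a distance-2 target** `T = insert p₁ (insert p₂ Q)` of a covered lossy big pair, in the vocabulary
off `K`: `T ∖ K = R ∪ {wₐ, w_b, w_c, p₁, p₂}` with `R` of rank `2` and `≥ 3` points, the coloop facts, and the
covering facts for `p₁` (off the `wₐ`-hyperplane, on the other two) and `p₂` (off the `w_b`-hyperplane). -/
theorem d2Target_shape (hG : G ∈ flatsQ M (5 + 1)) (hd : (gr M \ G).card = 2)
    (hk : kColoops M G = 1) (hs : ∀ e ∈ gr M, ∀ f ∈ gr M, e ≠ f → rkN M {e, f} = 2)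
    (hl : ∀ e ∈ gr M, M.Indep {e}) {B : Finset α} (hB : B ∈ thinMembers M 5 G)
    (hbig : 5 ≤ (B \ coloops M G).card) {z : α} (hz : z ∈ G \ clF M B) (h : loss M 5 G B z ≠ 0)
    (hno : ¬ (gtPts M 5 G (insert z B)).Nonempty) {T : Finset α} (hT : T ∈ d2Targets M 5 G (insert z B)) :
    ∃ (R : Finset α) (wa wb wc p1 p2 : α),
      T \ coloops M G = insert p1 (insert p2 (R ∪ {wa, wb, wc})) ∧ T ⊆ G ∧
      rkN M R = 2 ∧ 3 ≤ R.card ∧ R ⊆ G ∧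
      wa ∉ R ∧ wb ∉ R ∧ wc ∉ R ∧ wa ≠ wb ∧ wa ≠ wc ∧ wb ≠ wc ∧
      p1 ∉ R ∪ {wa, wb, wc} ∧ p2 ∉ R ∪ {wa, wb, wc} ∧ p1 ≠ p2 ∧
      p1 ∈ G ∧ p2 ∈ G ∧ wa ∈ G ∧ wb ∈ G ∧ wc ∈ G ∧
      wa ∉ clF M (R ∪ {wb, wc}) ∧ wb ∉ clF M (R ∪ {wa, wc}) ∧ wc ∉ clF M (R ∪ {wa, wb}) ∧
      p1 ∉ clF M (R ∪ {wb, wc}) ∧ p1 ∈ clF M (R ∪ {wa, wc}) ∧ p1 ∈ clF M (R ∪ {wa, wb}) ∧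
      p2 ∉ clF M (R ∪ {wa, wc}) ∧ p2 ∈ clF M (R ∪ {wb, wc}) ∧ p2 ∈ clF M (R ∪ {wa, wb}) := by
  have hd' : (gr M \ G).card ≤ 5 := by omega
  have hGg : G ⊆ gr M := (mem_flatsQ.1 hG).1
  have hKB : coloops M G ⊆ B := coloops_subset_of_mem_thinMembers hG hd' hB
  have hBG : B ⊆ G := subset_G_of_mem_thinMembers hB
  have hzG : z ∈ G := (Finset.mem_sdiff.1 hz).1
  have hzcl : z ∉ clF M B := (Finset.mem_sdiff.1 hz).2
  have hzB : z ∉ B := fun hzB => hzcl (subset_clF_of_subset_gr (hBG.trans hGg) hzB)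
  have hzK : z ∉ coloops M G := fun hzK => hzB (hKB hzK)
  have hQG : insert z B ⊆ G := Finset.insert_subset hzG hBG
  have hKQ : coloops M G ⊆ insert z B := hKB.trans (Finset.subset_insert _ _)
  obtain ⟨e₀, he₀⟩ := Finset.card_eq_one.1 (show (coloops M G).card = 1 by
    rw [← kColoops_eq_card_coloops]; exact hk)
  have he₀c : e₀ ∈ coloops M G := he₀ ▸ Finset.mem_singleton_self e₀
  have hrQ : rkN M (insert z B) = 6 := by
    rw [rkN_insert_of_notMem_clF (hGg hzG) hzcl, rkN_eq_five_of_mem_thinMembers hB]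
  have hrQs : rkN M (insert z B \ coloops M G) = 5 := by
    have := rkN_eq_rkN_sdiff_add_one hG hk (S := insert z B) hQG (Finset.Subset.refl _) hKQ
    omega
  have hcardQ : 6 ≤ (insert z B \ coloops M G).card := by
    rw [Finset.insert_sdiff_of_notMem _ hzK,
      Finset.card_insert_of_notMem (fun hzB' => hzB (Finset.mem_sdiff.1 hzB').1)]
    omega
  have hQsG : insert z B \ coloops M G ⊆ G := Finset.sdiff_subset.trans hQG
  have hfaces := thinFacesOf_eq_image_erase hG hd hk hs hl hB hbig hz h
  have h3 := card_coloops_eq_three_of_loss_ne_zero hG hd hk hs hl hB hbig hz h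
  -- the distance-2 pair and its two faces
  obtain ⟨p, hp, rfl⟩ := mem_d2Targets.1 hT
  obtain ⟨⟨hp1, hp2⟩, hne, F, hF, F', hF', hFF', hp1F, hp2F'⟩ := mem_d2Pts.1 hp
  have hFt := hF
  have hF't := hF'
  rw [hfaces, Finset.mem_image] at hF hF'
  obtain ⟨w, hw, rfl⟩ := hF
  obtain ⟨w', hw', rfl⟩ := hF'
  have hww' : w ≠ w' := by
    rintro rfl
    exact hFF' rfl
  -- the third coloop
  obtain ⟨w'', hw''⟩ := Finset.card_eq_one.1
    (show (((coloops M (insert z B \ coloops M G)).erase w).erase w').card = 1 by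
      rw [Finset.card_erase_of_mem (Finset.mem_erase.2 ⟨hww'.symm, hw'⟩), Finset.card_erase_of_mem hw, h3])
  have hw''mem : w'' ∈ ((coloops M (insert z B \ coloops M G)).erase w).erase w' :=
    hw'' ▸ Finset.mem_singleton_self w''
  rw [Finset.mem_erase, Finset.mem_erase] at hw''mem
  have hcol : coloops M (insert z B \ coloops M G) = {w, w', w''} :=
    coloops_eq_triple h3 hw hw' hw''mem.2.2 hww' hw''mem.2.1.symm hw''mem.1.symm
  have hCQ : {w, w', w''} ⊆ insert z B \ coloops M G := by
    rw [← hcol]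
    exact fun a ha => (mem_coloops.1 ha).1
  have hQ' : insert z B \ coloops M G = ((insert z B \ coloops M G) \ {w, w', w''}) ∪ {w, w', w''} :=
    (Finset.sdiff_union_of_subset hCQ).symm
  have hrk := rkN_sdiff_add_card_of_subset_coloops (M := M) (hQsG.trans hGg) (T := {w, w', w''})
    (by rw [← hcol])
  have hc3 : ({w, w', w''} : Finset α).card = 3 := by rw [← hcol]; exact h3
  rw [hrQs, hc3] at hrk
  have hcardR := Finset.card_sdiff_add_card_eq_card hCQ
  rw [hc3] at hcardR
  have hwR : w ∉ (insert z B \ coloops M G) \ {w, w', w''} := fun h' => (Finset.mem_sdiff.1 h').2 (by simp)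
  have hw'R : w' ∉ (insert z B \ coloops M G) \ {w, w', w''} := fun h' => (Finset.mem_sdiff.1 h').2 (by simp)
  have hw''R : w'' ∉ (insert z B \ coloops M G) \ {w, w', w''} := fun h' => (Finset.mem_sdiff.1 h').2 (by simp)
  have hcolw : ∀ v ∈ coloops M (insert z B \ coloops M G),
      v ∉ clF M ((insert z B \ coloops M G).erase v) := fun v hv => (mem_coloops.1 hv).2
  -- bridge: membership in `clF (Q.erase v)` gives membership in `clF (Q'.erase v)` for points `≠ e₀`
  have hbridge : ∀ v, ∀ x ∈ G, x ≠ e₀ → x ∈ clF M ((insert z B).erase v) →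
      x ∈ clF M ((insert z B \ coloops M G).erase v) := by
    intro v x hxG hxe hx
    have h1 := mem_clF_erase_coloop_of_mem_clF hG he₀c ((Finset.erase_subset _ _).trans hQG) hxG hxe hx
    have heq : ((insert z B).erase v).erase e₀ = (insert z B \ coloops M G).erase v := by
      rw [he₀, Finset.sdiff_singleton_eq_erase, Finset.erase_right_comm]
    rw [heq] at h1
    exact h1
  have hp1e : p.1 ≠ e₀ := fun h' => (Finset.mem_sdiff.1 hp1).2 (h' ▸ hKQ he₀c)
  have hp2e : p.2 ≠ e₀ := fun h' => (Finset.mem_sdiff.1 hp2).2 (h' ▸ hKQ he₀c)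
  have hp1K : p.1 ∉ coloops M G := fun hk' => (Finset.mem_sdiff.1 hp1).2 (hKQ hk')
  have hp2K : p.2 ∉ coloops M G := fun hk' => (Finset.mem_sdiff.1 hp2).2 (hKQ hk')
  have hp1Q : p.1 ∉ insert z B := (Finset.mem_sdiff.1 hp1).2
  have hp2Q : p.2 ∉ insert z B := (Finset.mem_sdiff.1 hp2).2
  have hface : ∀ v ∈ coloops M (insert z B \ coloops M G),
      (insert z B).erase v ∈ thinFacesOf M 5 G (insert z B) := by
    intro v hv
    rw [hfaces]
    exact Finset.mem_image_of_mem _ hv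
  have herase_ne : ∀ v ∈ coloops M (insert z B \ coloops M G), ∀ u, v ≠ u →
      (insert z B).erase v ≠ (insert z B).erase u := by
    intro v hv u hvu heq
    have hvQ : v ∈ insert z B := (Finset.mem_sdiff.1 (mem_coloops.1 hv).1).1
    have hmem : v ∈ (insert z B).erase u := Finset.mem_erase.2 ⟨hvu, hvQ⟩
    rw [← heq] at hmem
    exact (Finset.mem_erase.1 hmem).1 rfl
  -- covering
  have hcov1 : ∀ v ∈ coloops M (insert z B \ coloops M G), v ≠ w → p.1 ∈ clF M ((insert z B).erase v) :=
    fun v hv hvw => mem_clF_of_not_gtPts hG hd hk hs hl hB hbig hz h hno hp1 hFt hp1F (hface v hv)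
      (herase_ne v hv w hvw)
  have hcov2 : ∀ v ∈ coloops M (insert z B \ coloops M G), v ≠ w' → p.2 ∈ clF M ((insert z B).erase v) :=
    fun v hv hvw => mem_clF_of_not_gtPts hG hd hk hs hl hB hbig hz h hno hp2 hF't hp2F' (hface v hv)
      (herase_ne v hv w' hvw)
  have hsubQ : insert z B \ coloops M G ⊆ insert z B := Finset.sdiff_subset
  have hQ'b : insert z B \ coloops M G = ((insert z B \ coloops M G) \ {w, w', w''}) ∪ {w', w, w''} :=
    hQ'.trans triple_perm_aux
  have hQ'c : insert z B \ coloops M G = ((insert z B \ coloops M G) \ {w, w', w''}) ∪ {w'', w, w'} :=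
    hQ'.trans triple_perm_aux'
  refine ⟨(insert z B \ coloops M G) \ {w, w', w''}, w, w', w'', p.1, p.2, ?_, ?_, ?_, ?_, ?_, hwR, hw'R, hw''R,
    hww', hw''mem.2.1.symm, hw''mem.1.symm, ?_, ?_, hne, (Finset.mem_sdiff.1 hp1).1, (Finset.mem_sdiff.1 hp2).1,
    hQsG (hCQ (by simp)), hQsG (hCQ (by simp)), hQsG (hCQ (by simp)), ?_, ?_, ?_, ?_, ?_, ?_, ?_, ?_, ?_⟩
  · rw [Finset.insert_sdiff_of_notMem _ hp1K, Finset.insert_sdiff_of_notMem _ hp2K, ← hQ']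
  · exact Finset.insert_subset (Finset.mem_sdiff.1 hp1).1
      (Finset.insert_subset (Finset.mem_sdiff.1 hp2).1 hQG)
  · omega
  · omega
  · exact Finset.sdiff_subset.trans hQsG
  · rw [← hQ']
    exact fun h' => hp1Q (hsubQ h')
  · rw [← hQ']
    exact fun h' => hp2Q (hsubQ h')
  · exact fun h' => hcolw w hw (clF_mono (subset_erase_coloop_aux hQ' hwR hww' hw''mem.2.1.symm) h')
  · exact fun h' => hcolw w' hw' (clF_mono (subset_erase_coloop_aux hQ'b hw'R hww'.symm hw''mem.1.symm) h')
  · exact fun h' => hcolw w'' hw''mem.2.2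
      (clF_mono (subset_erase_coloop_aux hQ'c hw''R hw''mem.2.1 hw''mem.1) h')
  · exact fun h' => hp1F (clF_mono ((subset_erase_coloop_aux hQ' hwR hww' hw''mem.2.1.symm).trans
      (Finset.erase_subset_erase _ hsubQ)) h')
  · have h1 := hbridge w' p.1 (Finset.mem_sdiff.1 hp1).1 hp1e (hcov1 w' hw' hww'.symm)
    exact clF_mono (fun a ha => erase_coloop_subset_aux hQ'b a ha) h1
  · have h1 := hbridge w'' p.1 (Finset.mem_sdiff.1 hp1).1 hp1e (hcov1 w'' hw''mem.2.2 hw''mem.2.1)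
    exact clF_mono (fun a ha => erase_coloop_subset_aux hQ'c a ha) h1
  · exact fun h' => hp2F' (clF_mono ((subset_erase_coloop_aux hQ'b hw'R hww'.symm hw''mem.1.symm).trans
      (Finset.erase_subset_erase _ hsubQ)) h')
  · have h1 := hbridge w p.2 (Finset.mem_sdiff.1 hp2).1 hp2e (hcov2 w hw hww')
    exact clF_mono (fun a ha => erase_coloop_subset_aux hQ' a ha) h1
  · have h1 := hbridge w'' p.2 (Finset.mem_sdiff.1 hp2).1 hp2e (hcov2 w'' hw''mem.2.2 hw''mem.1)
    exact clF_mono (fun a ha => erase_coloop_subset_aux hQ'c a ha) h1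

end PercRepro.Shadow
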